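import Literature.NumberTheory.LFunctions.LapidusVanFrankenhuijsenVerticalProgressions
import Literature.NumberTheory.LFunctions.EulerMaclaurinZeta
import Mathlib.NumberTheory.LSeries.DirichletContinuation
import HarnessLib

/-!
# Refutation of `LapidusVanFrankenhuijsen2006_thm11_12` (false as typed; Theorem 11.12 false as printed)

Witness: `a = 1_{m odd}`, `G = L(s, χ₀ mod 2) = (1 - 2^{-s}) ζ(s)`, `θ₀ = -1`, screen `θ = -1/2`, pole set
`E = {1}`, truncation heights `T_n = n + 2` (`n ≥ 0`), `T_n = n - 2` (`n < 0`), `κ = 3`, `C = 375`,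
`D = 0`, `𝐩 = 2π / log 2`: every hypothesis of the fact holds (languidity from the tree's Euler–Maclaurin
bound `Literature.NumberTheory.LFunctions.norm_riemannZeta_le_of_neg_one_le_re` and Titchmarsh (2.12.2)
`norm_riemannZeta_le_of_re_pos`), yet `G(i n 𝐩) = (1 - e^{-2πin}) ζ(i n 𝐩) = 0` for EVERY `n ∈ ℤ`.
See the module docstring of `LapidusVanFrankenhuijsenVerticalProgressions` ("Status", "Sharpness") for
the whole family of counterexamples and for the true kernel `…_thm11_12_absConv`.

Since the 2026-08-16 verdict clean-up the refuted def is `@[deprecated]` (pointing at the corrected, proved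
fact `LapidusVanFrankenhuijsen2006_thm11_12_absConv`); its refutation must name it, so the deprecation linter
is silenced on exactly the two declarations below that do (`LapidusVanFrankenhuijsen2006_thm11_12_false` and
its conventional alias `not_LapidusVanFrankenhuijsen2006_thm11_12`).
-/

noncomputable section

namespace Literature.NumberTheory.LFunctions

open Filter Complex Topology

/-- Uniform polynomial bound for `ζ` on `Re s ≥ -1`, `|Im s| ≥ 1`: `‖ζ(s)‖ ≤ (|Im s| + 4)³`
(Euler–Maclaurin for `Re s ≤ 2`, Titchmarsh (2.12.2) for `Re s ≥ 2`).
[cite: Edwards1974, §6.4 eq. (1)] -/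
theorem norm_riemannZeta_le_cube_of_one_le_abs_im {s : ℂ} (hs : -1 ≤ s.re) (ht : 1 ≤ |s.im|) :
    ‖riemannZeta s‖ ≤ (|s.im| + 4) ^ 3 := by
  have hs1 : s ≠ 1 := by
    intro h; rw [h] at ht; norm_num at ht
  have him1 : 1 ≤ ‖s - 1‖ := ht.trans (by simpa using abs_im_le_norm (s - 1))
  set u : ℝ := |s.im| + 4 with hu
  have hu5 : 5 ≤ u := by rw [hu]; linarith
  rcases le_or_gt s.re 2 with hre | hre
  · -- `-1 ≤ Re s ≤ 2`: Euler–Maclaurin bound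
    have h := norm_riemannZeta_le_of_neg_one_le_re hs hs1
    have hns : ‖s‖ ≤ |s.im| + 2 := by
      refine (norm_le_abs_re_add_abs_im s).trans ?_
      have : |s.re| ≤ 2 := abs_le.mpr ⟨by linarith, hre⟩
      linarith
    have hns1 : ‖s + 1‖ ≤ |s.im| + 3 := (norm_add_le _ _).trans (by simp; linarith)
    have hns2 : ‖s + 2‖ ≤ |s.im| + 4 := (norm_add_le _ _).trans (by
      rw [Complex.norm_ofNat]; linarith)
    have h1 : 1 / ‖s - 1‖ ≤ 1 := by rw [div_le_one (by linarith)]; exact him1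
    have h0 : 0 ≤ |s.im| := abs_nonneg _
    have h2 : ‖s‖ * ‖s + 1‖ * ‖s + 2‖ ≤ u ^ 3 := by
      calc ‖s‖ * ‖s + 1‖ * ‖s + 2‖ ≤ (|s.im| + 2) * (|s.im| + 3) * (|s.im| + 4) := by
            gcongr
        _ ≤ u * u * u := by rw [hu]; gcongr <;> linarith
        _ = u ^ 3 := by ring
    have h3 : ‖s‖ ≤ u := by rw [hu]; linarith
    have hu3 : u ≤ u ^ 3 := by
      have hsq : (1 : ℝ) ≤ u * u := by nlinarith
      nlinarith [mul_le_mul_of_nonneg_left hsq (by linarith : (0 : ℝ) ≤ u)]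
    nlinarith
  · -- `Re s ≥ 2`: Titchmarsh (2.12.2)
    have hpos : 0 < s.re := by linarith
    have h := norm_riemannZeta_le_of_re_pos hpos hs1
    have hns : ‖s‖ ≤ s.re + |s.im| := by
      refine (norm_le_abs_re_add_abs_im s).trans ?_
      rw [abs_of_pos hpos]
    have hsm1 : s.re - 1 ≤ ‖s - 1‖ := by
      have := abs_re_le_norm (s - 1)
      rw [sub_re, one_re, abs_of_nonneg (by linarith)] at this
      exact this
    have hA : ‖s‖ / ‖s - 1‖ ≤ |s.im| + 2 := by
      rw [div_le_iff₀ (by linarith)]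
      nlinarith [abs_nonneg s.im]
    have hB : ‖s‖ / s.re ≤ |s.im| + 1 := by
      rw [div_le_iff₀ hpos]
      nlinarith [abs_nonneg s.im]
    have hu3 : 2 * u ≤ u ^ 3 := by
      have hsq : (2 : ℝ) ≤ u * u := by nlinarith
      nlinarith [mul_le_mul_of_nonneg_left hsq (by linarith : (0 : ℝ) ≤ u)]
    linarith

/-- The coefficients of the trivial Dirichlet character mod `2`, as real numbers. [folklore] -/
private lemma trivChar_two_apply (m : ℕ) :
    ((1 : DirichletCharacter ℂ 2) (m : ZMod 2)) = ((if Odd m then (1 : ℝ) else 0 : ℝ) : ℂ) := by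
  by_cases hm : Odd m
  · have hu : IsUnit (m : ZMod 2) := (ZMod.isUnit_iff_coprime m 2).mpr (Nat.coprime_two_right.mpr hm)
    rw [MulChar.one_apply hu, if_pos hm]; simp
  · have hu : ¬ IsUnit (m : ZMod 2) := fun h =>
      hm (Nat.coprime_two_right.mp ((ZMod.isUnit_iff_coprime m 2).mp h))
    rw [MulChar.map_nonunit _ hu, if_neg hm]; simp

/-- `L(s, χ₀ mod 2) = (1 - 2^{-s}) ζ(s)` for `s ≠ 1`. [folklore] -/
private lemma trivChar_two_eq {s : ℂ} (hs : s ≠ 1) :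
    DirichletCharacter.LFunctionTrivChar 2 s = (1 - (2 : ℂ) ^ (-s)) * riemannZeta s := by
  rw [DirichletCharacter.LFunctionTrivChar_eq_mul_riemannZeta hs, Nat.Prime.primeFactors Nat.prime_two,
    Finset.prod_singleton]
  norm_num

/-- `L(i n 𝐩, χ₀ mod 2) = 0` for `𝐩 = 2π / log 2` and every integer `n`. [folklore] -/
private lemma trivChar_two_zero (n : ℤ) :
    DirichletCharacter.LFunctionTrivChar 2
      (((0 : ℝ) : ℂ) + (n : ℂ) * ((2 * Real.pi / Real.log 2 : ℝ) : ℂ) * I) = 0 := by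
  have hlog : Real.log 2 ≠ 0 := (Real.log_pos one_lt_two).ne'
  set s : ℂ := ((0 : ℝ) : ℂ) + (n : ℂ) * ((2 * Real.pi / Real.log 2 : ℝ) : ℂ) * I with hs
  have hre : s.re = 0 := by
    simp only [hs, Complex.add_re, Complex.ofReal_re, Complex.mul_re, Complex.I_re, Complex.I_im,
      Complex.mul_im, Complex.ofReal_im, Complex.intCast_re, Complex.intCast_im]
    ring
  have hs1 : s ≠ 1 := by
    intro h
    have := congrArg Complex.re h
    rw [hre, Complex.one_re] at this
    norm_num at this
  rw [trivChar_two_eq hs1]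
  have h2 : (2 : ℂ) ^ (-s) = 1 := by
    rw [Complex.cpow_def_of_ne_zero two_ne_zero,
      show Complex.log 2 = ((Real.log 2 : ℝ) : ℂ) by
        rw [show (2 : ℂ) = ((2 : ℝ) : ℂ) by norm_num, ← Complex.ofReal_log (by norm_num)]]
    have hlogC : ((Real.log 2 : ℝ) : ℂ) ≠ 0 := by exact_mod_cast hlog
    have : ((Real.log 2 : ℝ) : ℂ) * -s = ((-n : ℤ) : ℂ) * (2 * Real.pi * I) := by
      rw [hs]; push_cast
      field_simp
      ring
    rw [this, Complex.exp_int_mul_two_pi_mul_I]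
  rw [h2, sub_self, zero_mul]

-- `LapidusVanFrankenhuijsen2006_thm11_12` is `@[deprecated]` (refuted here) and its refutation must name it;
-- REMOVE-WHEN the deprecated def is deleted from `LapidusVanFrankenhuijsenVerticalProgressions.lean`.
set_option linter.deprecated false in
/-- **`LapidusVanFrankenhuijsen2006_thm11_12` is false.** Witness `L(s, χ₀ mod 2) = (1 - 2^{-s})ζ(s)`
(`a = 1_{odd}`, `θ₀ = -1`, `θ = -1/2`, `E = {1}`, `T_n = ±(|n| + 2)`, `κ = 3`, `C = 375`, `D = 0`,
`𝐩 = 2π/log 2`): it vanishes on the whole progression `{i n 𝐩 : n ∈ ℤ}`.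
[cite: LapidusVanfrankenhuijsen2006, Thm 11.12 (refuted as printed; see module docstring)] -/
theorem LapidusVanFrankenhuijsen2006_thm11_12_false : ¬ LapidusVanFrankenhuijsen2006_thm11_12 := by
  intro h
  set G : ℂ → ℂ := DirichletCharacter.LFunctionTrivChar 2 with hG
  set a : ℕ → ℝ := fun m => if Odd m then 1 else 0 with ha
  set T : ℤ → ℝ := fun n => if 0 ≤ n then (n : ℝ) + 2 else (n : ℝ) - 2 with hT
  have hfa : (fun m => ((a m : ℝ) : ℂ)) = fun m : ℕ => (1 : DirichletCharacter ℂ 2) (m : ZMod 2) := by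
    funext m; rw [trivChar_two_apply]
  -- (H1), (H2)
  have h1 : ∀ m, 0 ≤ a m := fun m => by simp only [ha]; split_ifs <;> norm_num
  have h2 : ∃ m, 1 ≤ m ∧ 0 < a m := ⟨1, le_rfl, by simp [ha]⟩
  -- (H3) Dirichlet series on `Re s > 1`
  have h3 : ∀ s : ℂ, 1 < s.re →
      LSeriesSummable (fun m => ((a m : ℝ) : ℂ)) s ∧ G s = LSeries (fun m => ((a m : ℝ) : ℂ)) s := by
    intro s hs
    rw [hfa]
    exact ⟨DirichletCharacter.LSeriesSummable_of_one_lt_re _ hs,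
      DirichletCharacter.LFunction_eq_LSeries _ hs⟩
  -- (H5) holomorphy off the pole
  have h5 : DifferentiableOn ℂ G ({s : ℂ | (-1 : ℝ) < s.re} \ (↑({1} : Finset ℂ) : Set ℂ)) := by
    intro s hs
    have hs1 : s ≠ 1 := by
      have := hs.2; simpa using this
    exact (DirichletCharacter.differentiableAt_LFunction _ s (Or.inl hs1)).differentiableWithinAt
  -- (H6) meromorphy at the pole
  have h6 : ∀ e ∈ ({1} : Finset ℂ), MeromorphicAt G e ∧ (-1 / 2 : ℝ) < e.re := by
    intro e he
    rw [Finset.mem_singleton] at he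
    subst he
    refine ⟨?_, by norm_num⟩
    have hmer : MeromorphicAt (fun s : ℂ => (1 - (2 : ℂ) ^ (-s)) * ((s - 1)⁻¹ * riemannZeta₁ s)) 1 := by
      refine MeromorphicAt.mul ?_ (MeromorphicAt.mul ?_ ?_)
      · refine (Differentiable.analyticAt ?_ 1).meromorphicAt
        intro z
        exact (differentiableAt_const _).sub
          ((differentiableAt_id.neg).const_cpow (Or.inl two_ne_zero))
      · exact ((analyticAt_id.sub analyticAt_const).meromorphicAt).inv
      · exact (differentiable_riemannZeta₁.analyticAt 1).meromorphicAt
    refine hmer.congr ?_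
    filter_upwards [self_mem_nhdsWithin] with s hs
    rw [Set.mem_compl_iff, Set.mem_singleton_iff] at hs
    simp only [hG]
    rw [trivChar_two_eq hs, riemannZeta_eq_inv_sub_mul hs]
  -- growth of `G`: `‖G(s)‖ ≤ 3 (|Im s| + 4)³` for `Re s ≥ -1/2`, `|Im s| ≥ 1`
  have hgrowth : ∀ s : ℂ, -1 / 2 ≤ s.re → 1 ≤ |s.im| → ‖G s‖ ≤ 3 * (|s.im| + 4) ^ 3 := by
    intro s hsre hsim
    have hs1 : s ≠ 1 := by intro h; rw [h] at hsim; norm_num at hsim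
    simp only [hG]
    rw [trivChar_two_eq hs1, norm_mul]
    have hz := norm_riemannZeta_le_cube_of_one_le_abs_im (by linarith) hsim
    have hfac : ‖1 - (2 : ℂ) ^ (-s)‖ ≤ 3 := by
      refine (norm_sub_le _ _).trans ?_
      rw [norm_one, show (2 : ℂ) = ((2 : ℝ) : ℂ) by norm_num,
        Complex.norm_cpow_eq_rpow_re_of_pos two_pos, neg_re]
      have : (2 : ℝ) ^ (-s.re) ≤ (2 : ℝ) ^ (1 : ℝ) :=
        Real.rpow_le_rpow_of_exponent_le one_le_two (by linarith)
      rw [Real.rpow_one] at this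
      linarith
    have h0 : 0 ≤ (|s.im| + 4) ^ 3 := by positivity
    exact mul_le_mul hfac hz (norm_nonneg _) (by norm_num)
  -- (H7) languidity for the screen `Re s = -1/2`
  have hTpos : ∀ n : ℤ, 0 ≤ n → T n = n + 2 := fun n hn => by simp [hT, hn]
  have hTneg : ∀ n : ℤ, n < 0 → T n = n - 2 := fun n hn => by simp [hT, not_le.mpr hn]
  have hTabs : ∀ n : ℤ, 2 ≤ |T n| := by
    intro n
    rcases le_or_gt 0 n with hn | hn
    · rw [hTpos n hn]
      have : (0 : ℝ) ≤ n := by exact_mod_cast hn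
      rw [abs_of_nonneg (by linarith)]; linarith
    · rw [hTneg n hn]
      have : (n : ℝ) < 0 := by exact_mod_cast hn
      rw [abs_of_neg (by linarith)]; linarith
  have h7 : ∃ (κ C : ℝ) (T : ℤ → ℝ), 0 < C ∧ (∀ n : ℕ, 1 ≤ n → T (-(n : ℤ)) < 0 ∧ 0 < T n) ∧
      Tendsto (fun n : ℕ => T n) atTop atTop ∧ Tendsto (fun n : ℕ => T (-(n : ℤ))) atTop atBot ∧
      Tendsto (fun n : ℕ => T n / |T (-(n : ℤ))|) atTop (nhds 1) ∧
      (∀ (n : ℤ) (σ : ℝ), (-1 / 2 : ℝ) ≤ σ → ‖G ((σ : ℂ) + (T n : ℂ) * I)‖ ≤ C * (|T n| + 1) ^ κ) ∧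
      (∀ t : ℝ, 1 ≤ |t| → ‖G (((-1 / 2 : ℝ) : ℂ) + (t : ℂ) * I)‖ ≤ C * |t| ^ κ) := by
    refine ⟨3, 375, T, by norm_num, ?_, ?_, ?_, ?_, ?_, ?_⟩
    · intro n hn
      have hn' : (-(n : ℤ)) < 0 := by omega
      rw [hTneg _ hn', hTpos n (by exact_mod_cast n.zero_le)]
      push_cast
      constructor <;> linarith [(Nat.cast_nonneg n : (0 : ℝ) ≤ n)]
    · have : (fun n : ℕ => T n) = fun n : ℕ => (n : ℝ) + 2 := by
        funext n; rw [hTpos n (by exact_mod_cast n.zero_le)]; push_cast; ring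
      rw [this]
      exact tendsto_natCast_atTop_atTop.atTop_add tendsto_const_nhds
    · have hev : (fun n : ℕ => -(n : ℝ) - 2) =ᶠ[atTop] fun n : ℕ => T (-(n : ℤ)) := by
        filter_upwards [eventually_ge_atTop 1] with n hn
        rw [hTneg (-(n : ℤ)) (by omega)]; push_cast; ring
      refine Tendsto.congr' hev ?_
      have h1 : Tendsto (fun n : ℕ => -(n : ℝ)) atTop atBot :=
        tendsto_neg_atTop_atBot.comp tendsto_natCast_atTop_atTop
      exact h1.atBot_add tendsto_const_nhds
    · have hev : (fun _ : ℕ => (1 : ℝ)) =ᶠ[atTop] fun n : ℕ => T n / |T (-(n : ℤ))| := by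
        filter_upwards [eventually_ge_atTop 1] with n hn
        rw [hTneg (-(n : ℤ)) (by omega), hTpos n (by exact_mod_cast n.zero_le)]
        push_cast
        have h0 : (0 : ℝ) ≤ n := Nat.cast_nonneg n
        rw [abs_of_neg (by linarith), eq_comm, div_eq_one_iff_eq (by linarith)]
        ring
      exact tendsto_const_nhds.congr' hev
    · intro n σ hσ
      have him : ((σ : ℂ) + (T n : ℂ) * I).im = T n := by simp
      have hre : ((σ : ℂ) + (T n : ℂ) * I).re = σ := by simp
      have hb := hgrowth ((σ : ℂ) + (T n : ℂ) * I) (by rw [hre]; exact hσ)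
        (by rw [him]; linarith [hTabs n])
      rw [him] at hb
      refine hb.trans ?_
      rw [show ((|T n| + 1) ^ (3 : ℝ) : ℝ) = (|T n| + 1) ^ (3 : ℕ) by
        exact_mod_cast Real.rpow_natCast (|T n| + 1) 3]
      have h0 : 0 ≤ |T n| := abs_nonneg _
      nlinarith [pow_le_pow_left₀ (by positivity : (0 : ℝ) ≤ |T n| + 4)
        (by linarith : |T n| + 4 ≤ 4 * (|T n| + 1)) 3]
    · intro t ht
      have him : (((-1 / 2 : ℝ) : ℂ) + (t : ℂ) * I).im = t := by simp
      have hre : (((-1 / 2 : ℝ) : ℂ) + (t : ℂ) * I).re = -1 / 2 := by simp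
      have hb := hgrowth (((-1 / 2 : ℝ) : ℂ) + (t : ℂ) * I) (by rw [hre]) (by rw [him]; exact ht)
      rw [him] at hb
      refine hb.trans ?_
      rw [show (|t| ^ (3 : ℝ) : ℝ) = |t| ^ (3 : ℕ) by exact_mod_cast Real.rpow_natCast |t| 3]
      have h0 : 0 ≤ |t| := abs_nonneg _
      nlinarith [pow_le_pow_left₀ (by positivity : (0 : ℝ) ≤ |t| + 4)
        (by linarith : |t| + 4 ≤ 5 * |t|) 3]
  -- apply the fact and contradict
  have key := h a (-1) (-1 / 2) G {1} h1 h2 h3 (by norm_num) h5 h6 h7 0 (2 * Real.pi / Real.log 2)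
    (by norm_num) (div_pos (by positivity) (Real.log_pos one_lt_two))
  obtain ⟨n, hn⟩ := key.exists
  exact hn (trivChar_two_zero n)

-- the alias must name the deprecated def too; REMOVE-WHEN the deprecated def is deleted.
set_option linter.deprecated false in
/-- Conventional name (`not_<decl>`) of the refutation of the deprecated named fact
`LapidusVanFrankenhuijsen2006_thm11_12` (= `LapidusVanFrankenhuijsen2006_thm11_12_false`).
[cite: LapidusVanfrankenhuijsen2006, Thm 11.12 (refuted as printed; see module docstring)] -/
theorem not_LapidusVanFrankenhuijsen2006_thm11_12 : ¬ LapidusVanFrankenhuijsen2006_thm11_12 :=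
  LapidusVanFrankenhuijsen2006_thm11_12_false

end Literature.NumberTheory.LFunctions

end
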